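/-
Lead `ym-line-sgb-k1` (seat prover-ym-line-sgb-k1-g0-0), route `SteinGapBootstrap`, crux `SteinBlockTransferG`
(stmt-QuantumFields-22998), line `birth`: registered stub `stub_rung_unitRate` (the BC5 first rung), BY NAME — closed VACUOUSLY.
-/
import Summits.QuantumFields.YangMills.Theorems.SteinGapBootstrapAssemblyPrep

/-!
# Crux `SteinBlockTransferG`, line `birth`: the BC5 rung `stub_rung_unitRate` holds — VACUOUSLY, for every compact simple `G`

The rung (plan-only first rung of the line «all-axes transfer», BC5 of route `SteinGapBootstrap`) asserts the Stein transfer bound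
`|probeCov_μ(n) − g_D(n)| ≤ C (1 + n)^K β^{−δ}` for torus-limit states that are pair-clustering across every axis hyperplane at a rate
`m ≥ 1`.  Recorded here: for `β ≥ β₁(G, r)` NO torus-limit state clusters at rate `≥ 1` in that sense, so the rung holds with any
constants — no generator comparison is exercised.

Proof (`eventually_no_unitRate_clustering`).  The tree's local free-gluon law for the exponential probe
(`EquipartitionPinsProbe.stub_localLaw`, fed by `stub_equipartition ∘ freeEnergyLogCoefficient_proof` — the engine of the proved rung
`XiDiv`) gives `D ≥ 1` with `probeCov_μ(n) → g_D(n) = 2^{−D}((1 − c_n²)^{−D/2} − 1)` uniformly over torus-limit states, and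
`g_D(n) ≥ 2^{−D}(D/2) c_n² ≥ K₀ e^{−n/2}` (`corr_subexp` with `ε = 1/4`, Bernoulli bound `rpow_neg_sub_one_ge`).  Pick `n₁` with
`e^{n₁/2} ≥ 4/K₀`, so `g_D(n₁) ≥ 4 e^{−n₁}`; for `β ≥ β₁`, `probeCov_μ(n₁) > g_D(n₁)/2 ≥ 2 e^{−n₁}`.  But the probe at the origin
`(1,2)`-plaquette is a time-zero spatial cylinder observable (`probe_facts`) and its translate by `n₁ e₀` lives in `{x₀ ≥ n₁}`, so
clustering at rate `m ≥ 1` across the time hyperplane gives `probeCov_μ(n₁) ≤ 2 e^{−m n₁} ≤ 2 e^{−n₁}` — contradiction.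

CONSEQUENCE FOR THE LINE (lead's note to the planner of record ym-idea-4 and the tribunal): the BC5 witness of the route is vacuous by
the PROVED qualitative rung `XiDiv`; together with `…ClusterRate` / `…FloorRate` / `…OfColdBox` (the crux as filed ⇐ the all-`G` torus
plaquette floor) this shows that none of the line's registered statements isolates Stein content except the XL stub
`stub_steinTransferAllAxes` in the window `β^{−ε_floor} ≲ m < 1`… which the floor, once proved, also empties.  HONEST FRAMING:
RECORD-label rung R2ξ′ only; nothing here bears on the Yang–Mills mass gap.
-/

set_option autoImplicit false

noncomputable section

open MeasureTheory Filter Topology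
open Literature.MathematicalPhysics
open Literature.MathematicalPhysics.QuantumFieldTheory hiding ZdEdge Site
open Literature.MathematicalPhysics.QuantumLattice
open Summit.QuantumFields.YangMills.Theorems
open Summit.QuantumFields.YangMills.Theorems.WeakCouplingRates
open Summit.QuantumFields.YangMills.Theorems.SteinGapBootstrap

namespace Summit.QuantumFields.YangMills.Cruxes.SteinBlockTransferG.AllAxesTransfer

/-- **No torus-limit state clusters at a unit rate (all large `β`, every compact simple `G`).**  For `β ≥ β₁(G, r)`, no
`μ ∈ infiniteVolumeLimitPoints r.ρ β` is pair-clustering across every axis hyperplane (half-space cylinder observables, sup-norm form)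
at a rate `m ≥ 1`: the local free-gluon law pins the probe covariance at a fixed separation `n₁` to `g_D(n₁) ≥ 4e^{−n₁}`, while
clustering across the time hyperplane would make it `≤ 2e^{−n₁}`. -/
theorem eventually_no_unitRate_clustering
    {G : Type} [Group G] [TopologicalSpace G] [IsTopologicalGroup G] [CompactSpace G]
    (hG : IsCompactSimpleLieGroup G) :
    letI : MeasurableSpace G := borel G
    haveI : BorelSpace G := ⟨rfl⟩
    ∀ r : LatticeRep G, ∃ β₁ : ℝ, ∀ β : ℝ, β₁ ≤ β →
      ∀ μ ∈ infiniteVolumeLimitPoints (d := 4) r.ρ β, ∀ m : ℝ, 1 ≤ m →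
      ¬ (∀ (i : Fin 4) (t : ℕ) (A B : LGConfig 4 G → ℝ) (SA SB : Finset (QuantumLattice.ZdEdge 4)),
          IsCylinder A SA → IsCylinder B SB → Continuous A → Continuous B →
          (∀ e ∈ SA, e.1 i ≤ 0 ∧ (e.2 = i → e.1 i ≤ -1)) → (∀ e ∈ SB, (t : ℤ) ≤ e.1 i) →
          ∀ a b : ℝ, (∀ U, |A U| ≤ a) → (∀ U, |B U| ≤ b) →
          |(∫ U, A U * B U ∂μ) - (∫ U, A U ∂μ) * (∫ U, B U ∂μ)| ≤ 2 * Real.exp (-(m * t)) * a * b) := by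
  letI : MeasurableSpace G := borel G
  haveI : BorelSpace G := ⟨rfl⟩
  intro r
  obtain ⟨D, hD, hlim⟩ := EquipartitionPinsProbe.stub_localLaw G hG r
    (EquipartitionPinsProbe.stub_equipartition G hG r (freeEnergyLogCoefficient_proof G hG r))
  -- floor of the free profile: `g_D(n) ≥ K₀ e^{-n/2}`
  obtain ⟨Cc, hCc, hCn⟩ := EquipartitionPinsProbe.Reduction.corr_subexp (ε := 1 / 4) (by norm_num)
  have hD' : (0 : ℝ) < D := by exact_mod_cast hD
  set K₀ : ℝ := (2 : ℝ) ^ (-(D : ℝ)) * ((D : ℝ) / 2 * Cc ^ 2) with hK₀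
  have h2D : 0 < (2 : ℝ) ^ (-(D : ℝ)) := Real.rpow_pos_of_pos (by norm_num) _
  have hK₀pos : 0 < K₀ := by positivity
  -- a separation `n₁ ≥ 1` with `4 / K₀ ≤ e^{n₁/2}`
  obtain ⟨n₁, hn₁, hn₁1⟩ : ∃ n₁ : ℕ, 4 / K₀ ≤ Real.exp ((n₁ : ℝ) / 2) ∧ 1 ≤ n₁ := by
    have htend : Tendsto (fun n : ℕ => Real.exp ((n : ℝ) / 2)) atTop atTop :=
      Real.tendsto_exp_atTop.comp (tendsto_natCast_atTop_atTop.atTop_div_const (by norm_num))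
    exact ((htend.eventually_ge_atTop _).and (eventually_ge_atTop 1)).exists
  have hn₁0 : (n₁ : ℤ) ≠ 0 := by exact_mod_cast (Nat.one_le_iff_ne_zero.1 hn₁1)
  set c : ℝ := curvaturePlaquetteCorr (d := 4) (by norm_num) (n₁ : ℤ) with hcdef
  have hc0 : 0 < c := EquipartitionPinsProbe.Reduction.corr_pos hn₁0
  have hc1 : c ≤ 2 / 3 := EquipartitionPinsProbe.Reduction.corr_le hn₁0
  have hcfloor : Cc * Real.exp (-(1 / 4 * (n₁ : ℝ))) ≤ c := by
    have h := hCn n₁ (Nat.one_le_iff_ne_zero.1 hn₁1)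
    simpa [Int.cast_natCast] using h
  set γ : ℝ := (2 : ℝ) ^ (-(D : ℝ)) * ((1 - c ^ 2) ^ (-((D : ℝ) / 2)) - 1) with hγ
  have hγfloor : K₀ * Real.exp (-((n₁ : ℝ) / 2)) ≤ γ := by
    have hx1 : c ^ 2 < 1 := by nlinarith
    have hB := EquipartitionPinsProbe.Reduction.rpow_neg_sub_one_ge hx1 (a := (D : ℝ) / 2) (by positivity)
    have he0 : 0 ≤ Cc * Real.exp (-(1 / 4 * (n₁ : ℝ))) := by positivity
    have hsq : (Cc * Real.exp (-(1 / 4 * (n₁ : ℝ)))) ^ 2 ≤ c ^ 2 := pow_le_pow_left₀ he0 hcfloor 2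
    have hexp : (Cc * Real.exp (-(1 / 4 * (n₁ : ℝ)))) ^ 2 = Cc ^ 2 * Real.exp (-((n₁ : ℝ) / 2)) := by
      rw [mul_pow, ← Real.exp_nat_mul]
      congr 1
      congr 1
      push_cast
      ring
    rw [hexp] at hsq
    calc K₀ * Real.exp (-((n₁ : ℝ) / 2))
        = (2 : ℝ) ^ (-(D : ℝ)) * ((D : ℝ) / 2 * (Cc ^ 2 * Real.exp (-((n₁ : ℝ) / 2)))) := by
          rw [hK₀]; ring
      _ ≤ (2 : ℝ) ^ (-(D : ℝ)) * ((D : ℝ) / 2 * c ^ 2) :=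
          mul_le_mul_of_nonneg_left (mul_le_mul_of_nonneg_left hsq (by positivity)) h2D.le
      _ ≤ γ := by
          rw [hγ]
          exact mul_le_mul_of_nonneg_left (by simpa [neg_div] using hB) h2D.le
  have hγ4 : 4 * Real.exp (-(n₁ : ℝ)) ≤ γ := by
    refine le_trans ?_ hγfloor
    have hexp : Real.exp (-(n₁ : ℝ)) = Real.exp (-((n₁ : ℝ) / 2)) * (Real.exp ((n₁ : ℝ) / 2))⁻¹ := by
      rw [← Real.exp_neg, ← Real.exp_add]
      congr 1
      ring
    have h4 : 4 ≤ K₀ * Real.exp ((n₁ : ℝ) / 2) := by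
      have := (div_le_iff₀ hK₀pos).1 hn₁
      linarith [this]
    have hEpos : 0 < Real.exp ((n₁ : ℝ) / 2) := Real.exp_pos _
    rw [hexp]
    calc 4 * (Real.exp (-((n₁ : ℝ) / 2)) * (Real.exp ((n₁ : ℝ) / 2))⁻¹)
        = (4 * (Real.exp ((n₁ : ℝ) / 2))⁻¹) * Real.exp (-((n₁ : ℝ) / 2)) := by ring
      _ ≤ K₀ * Real.exp (-((n₁ : ℝ) / 2)) := by
          refine mul_le_mul_of_nonneg_right ?_ (Real.exp_pos _).le
          rw [← div_eq_mul_inv, div_le_iff₀ hEpos]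
          exact h4
  have hγpos : 0 < γ := lt_of_lt_of_le (by positivity) hγ4
  -- the local law at separation `n₁`, precision `γ / 2`
  obtain ⟨β₁, hβ₁⟩ := eventually_atTop.1 (hlim n₁ (γ / 2) (by positivity))
  refine ⟨β₁, fun β hβ μ hμ m hm hclus => ?_⟩
  have hloc := hβ₁ β hβ μ hμ
  rw [EquipartitionPinsProbe.stub_gaussianProfile D n₁] at hloc
  -- the probe and its translate as half-space observables across the time hyperplane
  obtain ⟨S₀, hPcyl, hS₀, hPc, hPb⟩ := probe_facts (G := G) r.ρ r.continuous β
  set P : LGConfig 4 G → ℝ := fun U => Real.exp (-2 * max (β * ((r.N : ℝ) - plaquetteObs r.ρ 0 1 2 U)) 0)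
    with hPdef
  have hP : ∀ U, P U = Real.exp (-2 * max (β * ((r.N : ℝ) - plaquetteObs r.ρ 0 1 2 U)) 0) := fun U => rfl
  have hSA : ∀ e ∈ S₀, e.1 (0 : Fin 4) ≤ 0 ∧ (e.2 = (0 : Fin 4) → e.1 0 ≤ -1) := fun e he =>
    ⟨(hS₀ e he).1.le, fun h => absurd h (hS₀ e he).2⟩
  have hSB : ∀ e ∈ S₀.image (fun e : QuantumLattice.ZdEdge 4 => (e.1 + Pi.single 0 (n₁ : ℤ), e.2)),
      (n₁ : ℤ) ≤ (e : QuantumLattice.ZdEdge 4).1 (0 : Fin 4) := by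
    intro e he
    obtain ⟨e', he', rfl⟩ := Finset.mem_image.1 he
    have h0 := (hS₀ e' he').1
    simp only [Pi.add_apply, Pi.single_eq_same, h0, zero_add, le_refl]
  have hB := hclus 0 n₁ P (fun U => P (timeShiftLG (G := G) n₁ U)) S₀ _ hPcyl (isCylinder_timeShift hPcyl n₁)
    hPc (hPc.comp (continuous_timeShiftLG n₁)) hSA hSB 1 1 hPb (fun U => hPb _)
  change |(∫ U, P U * P (configShift (-(Pi.single 0 (n₁ : ℤ))) U) ∂μ) -
      (∫ U, P U ∂μ) * (∫ U, P (configShift (-(Pi.single 0 (n₁ : ℤ))) U) ∂μ)| ≤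
        2 * Real.exp (-(m * (n₁ : ℕ))) * 1 * 1 at hB
  simp only [← hP] at hloc
  -- contradiction: `γ/2 < Cov ≤ 2 e^{-m n₁} ≤ 2 e^{-n₁} ≤ γ/2`
  have hm1 : Real.exp (-(m * (n₁ : ℕ))) ≤ Real.exp (-(n₁ : ℝ)) := by
    refine Real.exp_le_exp.2 ?_
    have : (0 : ℝ) ≤ (n₁ : ℝ) := Nat.cast_nonneg _
    nlinarith
  have hloc' := (abs_lt.1 hloc).1
  have hB' := (abs_le.1 hB).2
  linarith

/-- **Registered stub `stub_rung_unitRate` of crux `SteinBlockTransferG` (line `birth`; the BC5 plan-only first rung), CLOSED —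
VACUOUSLY**: for `β ≥ β₁(G, r)` no torus-limit state is pair-clustering across every axis hyperplane at a rate `m ≥ 1`
(`eventually_no_unitRate_clustering`, from the tree's local free-gluon law), so the Stein transfer bound at unit rate holds with
`K = 0`, `δ = 1`, `C = 1`.  No generator comparison is exercised; recorded as evidence that the rung does not witness the line's
lever. -/
theorem stub_rung_unitRate :
    ∀ (G : Type) [Group G] [TopologicalSpace G] [IsTopologicalGroup G] [CompactSpace G], Literature.MathematicalPhysics.QuantumFieldTheory.IsCompactSimpleLieGroup G → (letI : MeasurableSpace G := borel G; haveI : BorelSpace G := ⟨rfl⟩; ∀ r : Literature.MathematicalPhysics.QuantumFieldTheory.LatticeRep G, ∀ C₀ : ℝ, ∃ (K δ C β₀ : ℝ), 0 < δ ∧ 0 < C ∧ ∀ β : ℝ, β₀ ≤ β → ∀ μ ∈ Literature.MathematicalPhysics.QuantumLattice.infiniteVolumeLimitPoints (d := 4) r.ρ β, (∀ (x : Literature.Probability.LatticeModels.Site 4) (i j : Fin 4), i ≠ j → ∫ U, ((r.N : ℝ) - Literature.MathematicalPhysics.QuantumLattice.plaquetteObs r.ρ x i j U) ∂μ ≤ C₀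 / β) → ∀ m : ℝ, 1 ≤ m → (∀ (i : Fin 4) (t : ℕ) (A B : Literature.MathematicalPhysics.QuantumLattice.LGConfig 4 (G) → ℝ) (SA SB : Finset (Literature.MathematicalPhysics.QuantumLattice.ZdEdge 4)), Literature.MathematicalPhysics.QuantumLattice.IsCylinder A SA → Literature.MathematicalPhysics.QuantumLattice.IsCylinder B SB → Continuous A → Continuous B → (∀ e ∈ SA, e.1 i ≤ 0 ∧ (e.2 = i → e.1 i ≤ -1)) → (∀ e ∈ SB, (t : ℤ) ≤ e.1 i) → ∀ a b : ℝ, (∀ U, |A U| ≤ a) → (∀ U, |B U| ≤ b) → |(∫ U, A U * B U ∂μ) - (∫ U, A U ∂μ) * (∫ U, B U ∂μ)| ≤ 2 * Real.exp (-(m * t)) * a * b) → ∀ n : ℕ, 1 ≤ n → let P : Literature.MathematicalPhysics.QuantumLattice.LGConfig 4 (G) → ℝ := fun U => Real.exp (-2 * max (β * ((r.N : ℝ) - Literature.MathematicalPhysics.QuantumLattice.plaquetteObs r.ρ 0 1 2 U)) 0); let D : ℝ := (Module.finrank ℝ ↥(Submodule.span ℝ {X : Matrix (Fin r.N) (Fin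 r.N) ℂ | ∀ t : ℝ, NormedSpace.exp ((t : ℂ) • X) ∈ Set.range r.ρ}) : ℝ); let c₂ : ℝ := Literature.MathematicalPhysics.QuantumFieldTheory.curvaturePlaquetteCorr (d := 4) (by norm_num) (n : ℤ); |((∫ U, P U * P (Summit.QuantumFields.YangMills.Theorems.WeakCouplingRates.timeShiftLG (G := G) n U) ∂μ) - (∫ U, P U ∂μ) * (∫ U, P (Summit.QuantumFields.YangMills.Theorems.WeakCouplingRates.timeShiftLG (G := G) n U) ∂μ)) - (2 : ℝ) ^ (-D) * ((1 - c₂ ^ 2) ^ (-(D / 2)) - 1)| ≤ C * (1 + n) ^ K * β ^ (-δ)) := by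
  intro G _ _ _ _ hG
  letI : MeasurableSpace G := borel G
  haveI : BorelSpace G := ⟨rfl⟩
  intro r C₀
  obtain ⟨β₁, hβ₁⟩ := eventually_no_unitRate_clustering hG r
  refine ⟨0, 1, 1, β₁, one_pos, one_pos, ?_⟩
  intro β hβ μ hμ _hi m hm hclus n _hn
  exact (hβ₁ β hβ μ hμ m hm hclus).elim

end Summit.QuantumFields.YangMills.Cruxes.SteinBlockTransferG.AllAxesTransfer

end
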